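import Mathlib
import Summits.Ventures.PercRepro2.Defs
import Summits.Ventures.PercRepro2.Independence
import Summits.Ventures.PercRepro2.Harris
import Summits.Ventures.PercRepro2.Graph
import Summits.Ventures.PercRepro2.Exploration
import Summits.Ventures.PercRepro2.Events
import Summits.Ventures.PercRepro2.Statements
import Summits.Ventures.PercRepro2.FourFunctions
import Summits.Ventures.PercRepro2.Induced
import Summits.Ventures.PercRepro2.Frontier
import Summits.Ventures.PercRepro2.ObsIndependence
import Summits.Ventures.PercRepro2.BHK
import Summits.Ventures.PercRepro2.BHKEvents
import Summits.Ventures.PercRepro2.ClusterProperty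

/-!
# Order preservation for general monotone cluster properties (blind cell PercRepro2, p1; R10f)

`orderPreserving_fun_of_nonneg`: for an up-set `𝓤` and a nonnegative monotone cluster property
`f` (Kozma–Nitzan §5.1, `IsMonotoneClusterProperty`),
`E f(a) ≤ E f(o) ⟹ E[f(a) 1{C(o) ∈ 𝓤}] ≤ E[f(o) 1{C(o) ∈ 𝓤}]`
— the indicator case is `orderPreserving_cluster` (OrderPreservation.lean); the proof is the same
with the functional forms `bhk_same_cluster_fun` / `bhk_cross_cluster_fun` of `ClusterProperty.lean`
(nonnegativity can be removed by shifting `f`, as in `KNGeneral.lean`).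
Also the small expectation toolbox used by `KNGeneral.lean`.
-/

namespace Summit.Ventures.PercRepro2

section Tools

variable {V : Type*} {E : Type*} [Fintype E] [DecidableEq E] {R : Type*} [Field R]
  [LinearOrder R] [IsStrictOrderedRing R]

omit [LinearOrder R] [IsStrictOrderedRing R] in
/-- `E[g 1_{A ∩ B}] + E[g 1_{A ∩ Bᶜ}] = E[g 1_A]`. -/
lemma expect_mul_indicator_inter_add (p : E → R) (g : Config E → R) (A B : Set (Config E)) :
    expect p (fun ω => g ω * (A ∩ B).indicator 1 ω) +
        expect p (fun ω => g ω * (A ∩ Bᶜ).indicator 1 ω) =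
      expect p (fun ω => g ω * A.indicator 1 ω) := by
  rw [← expect_add]
  congr 1
  funext ω
  simp only [Pi.add_apply]
  by_cases hA : ω ∈ A <;> by_cases hB : ω ∈ B <;> simp [hA, hB]

omit [LinearOrder R] [IsStrictOrderedRing R] in
/-- Observables agreeing on `A` have the same `A`-restricted expectation. -/
lemma expect_mul_indicator_congr (p : E → R) {g g' : Config E → R} {A : Set (Config E)}
    (h : ∀ ω ∈ A, g ω = g' ω) :
    expect p (fun ω => g ω * A.indicator 1 ω) = expect p (fun ω => g' ω * A.indicator 1 ω) := by
  congr 1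
  funext ω
  by_cases hA : ω ∈ A
  · rw [h ω hA]
  · simp [hA]

/-- `E[g 1_A] ≥ 0` for `g ≥ 0`. -/
lemma expect_mul_indicator_nonneg {p : E → R} (hp : IsProbVec p) {g : Config E → R}
    (hg : ∀ ω, 0 ≤ g ω) (A : Set (Config E)) : 0 ≤ expect p (fun ω => g ω * A.indicator 1 ω) :=
  expect_nonneg hp fun ω => mul_nonneg (hg ω) (Set.indicator_apply_nonneg fun _ => zero_le_one)

/-- `E[g 1_A] ≤ c · P(A)` for `g ≤ c`. -/
lemma expect_mul_indicator_le {p : E → R} (hp : IsProbVec p) {g : Config E → R} {c : R}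
    (hg : ∀ ω, g ω ≤ c) (A : Set (Config E)) :
    expect p (fun ω => g ω * A.indicator 1 ω) ≤ c * prob p A := by
  rw [prob_eq_expect_indicator, ← expect_const_mul]
  refine expect_mono hp fun ω => ?_
  exact mul_le_mul_of_nonneg_right (hg ω) (Set.indicator_apply_nonneg fun _ => zero_le_one)

/-- Dividing `x · d ≤ y · d` by `d ≥ 0` when `x ≤ c · d`. -/
lemma le_of_mul_le_mul_of_le' {x y d c : R} (hx : x ≤ c * d) (hx0 : 0 ≤ x) (hy0 : 0 ≤ y)
    (hd : 0 ≤ d) (h : x * d ≤ y * d) : x ≤ y := by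
  rcases hd.lt_or_eq with hd | hd
  · exact le_of_mul_le_mul_right h hd
  · subst hd
    rw [mul_zero] at hx
    exact (le_antisymm hx hx0).le.trans hy0

end Tools

section OrderPreservationFun

variable {V : Type*} {E : Type*} [Fintype E] [DecidableEq E] [Fintype V] [DecidableEq V]
  {R : Type*} [Field R] [LinearOrder R] [IsStrictOrderedRing R]

/-- **R10f for nonnegative monotone cluster properties**: for an up-set `𝓤`,
`E f(a) ≤ E f(o)` implies `E[f(a) 1{C(o) ∈ 𝓤}] ≤ E[f(o) 1{C(o) ∈ 𝓤}]`. -/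
theorem orderPreserving_fun_of_nonneg (p : E → R) (hp : IsProbVec p) (ends : E → Sym2 V) (o a : V)
    {𝓤 : Set (Set V)} (h𝓤 : IsUpperSet 𝓤) {f : V → Config E → R}
    (hf : IsMonotoneClusterProperty ends f) (hf0 : ∀ x ω, 0 ≤ f x ω)
    (h : expect p (f a) ≤ expect p (f o)) :
    expect p (fun ω => f a ω * (clusterInEvent ends o 𝓤).indicator 1 ω) ≤
      expect p (fun ω => f o ω * (clusterInEvent ends o 𝓤).indicator 1 ω) := by
  classical
  -- the indicator cluster property of `𝓤` at `o`
  have hind : IsMonotoneClusterProperty ends (clusterIndicator (R := R) ends 𝓤) :=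
    isMonotoneClusterProperty_clusterIndicator ends h𝓤
  have hind0 : ∀ ω, 0 ≤ clusterIndicator (R := R) ends 𝓤 o ω := fun ω =>
    Set.indicator_apply_nonneg fun _ => zero_le_one
  -- splits along `{o ↔ a}` / `D`
  have s1 : expect p (fun ω => f a ω * (connEvent ends o a).indicator 1 ω) +
      expect p (fun ω => f a ω * ((connEvent ends o a)ᶜ).indicator 1 ω) = expect p (f a) := by
    have := expect_mul_indicator_inter_add p (f a) Set.univ (connEvent ends o a)
    simpa only [Set.univ_inter, Set.indicator_univ, Pi.one_apply, mul_one] using this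
  have s2 : expect p (fun ω => f o ω * (connEvent ends o a).indicator 1 ω) +
      expect p (fun ω => f o ω * ((connEvent ends o a)ᶜ).indicator 1 ω) = expect p (f o) := by
    have := expect_mul_indicator_inter_add p (f o) Set.univ (connEvent ends o a)
    simpa only [Set.univ_inter, Set.indicator_univ, Pi.one_apply, mul_one] using this
  have s3 : expect p (fun ω => f a ω * (clusterInEvent ends o 𝓤).indicator 1 ω *
        (connEvent ends o a).indicator 1 ω) +
      expect p (fun ω => f a ω * (clusterInEvent ends o 𝓤).indicator 1 ω *
        ((connEvent ends o a)ᶜ).indicator 1 ω) =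
      expect p (fun ω => f a ω * (clusterInEvent ends o 𝓤).indicator 1 ω) := by
    have := expect_mul_indicator_inter_add p
      (fun ω => f a ω * (clusterInEvent ends o 𝓤).indicator 1 ω) Set.univ (connEvent ends o a)
    simpa only [Set.univ_inter, Set.indicator_univ, Pi.one_apply, mul_one] using this
  have s4 : expect p (fun ω => f o ω * (clusterInEvent ends o 𝓤).indicator 1 ω *
        (connEvent ends o a).indicator 1 ω) +
      expect p (fun ω => f o ω * (clusterInEvent ends o 𝓤).indicator 1 ω *
        ((connEvent ends o a)ᶜ).indicator 1 ω) =
      expect p (fun ω => f o ω * (clusterInEvent ends o 𝓤).indicator 1 ω) := by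
    have := expect_mul_indicator_inter_add p
      (fun ω => f o ω * (clusterInEvent ends o 𝓤).indicator 1 ω) Set.univ (connEvent ends o a)
    simpa only [Set.univ_inter, Set.indicator_univ, Pi.one_apply, mul_one] using this
  -- on `{o ↔ a}` the values agree
  have c1 : expect p (fun ω => f a ω * (connEvent ends o a).indicator 1 ω) =
      expect p (fun ω => f o ω * (connEvent ends o a).indicator 1 ω) :=
    expect_mul_indicator_congr p fun _ hω => (hf.eq_of_conn hω).symm
  have c2 : expect p (fun ω => f a ω * (clusterInEvent ends o 𝓤).indicator 1 ω *
        (connEvent ends o a).indicator 1 ω) =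
      expect p (fun ω => f o ω * (clusterInEvent ends o 𝓤).indicator 1 ω *
        (connEvent ends o a).indicator 1 ω) :=
    expect_mul_indicator_congr p fun _ hω => by rw [hf.eq_of_conn hω]
  -- reduced hypothesis and claim
  have hD' : expect p (fun ω => f a ω * ((connEvent ends o a)ᶜ).indicator 1 ω) ≤
      expect p (fun ω => f o ω * ((connEvent ends o a)ᶜ).indicator 1 ω) := by linarith
  suffices hmain : expect p (fun ω => f a ω * (clusterInEvent ends o 𝓤).indicator 1 ω *
        ((connEvent ends o a)ᶜ).indicator 1 ω) ≤
      expect p (fun ω => f o ω * (clusterInEvent ends o 𝓤).indicator 1 ω *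
        ((connEvent ends o a)ᶜ).indicator 1 ω) by linarith
  -- the two BHK inequalities, in syntactic form
  have hcross : expect p (fun ω => (clusterInEvent ends o 𝓤).indicator 1 ω * f a ω *
        ((connEvent ends o a)ᶜ).indicator 1 ω) * prob p (connEvent ends o a)ᶜ ≤
      expect p (fun ω => (clusterInEvent ends o 𝓤).indicator 1 ω *
        ((connEvent ends o a)ᶜ).indicator 1 ω) *
      expect p (fun ω => f a ω * ((connEvent ends o a)ᶜ).indicator 1 ω) :=
    bhk_cross_cluster_fun p hp ends o a hind hf hind0
  have hsame : expect p (fun ω => (clusterInEvent ends o 𝓤).indicator 1 ω *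
        ((connEvent ends o a)ᶜ).indicator 1 ω) *
      expect p (fun ω => f o ω * ((connEvent ends o a)ᶜ).indicator 1 ω) ≤
      expect p (fun ω => (clusterInEvent ends o 𝓤).indicator 1 ω * f o ω *
        ((connEvent ends o a)ᶜ).indicator 1 ω) * prob p (connEvent ends o a)ᶜ :=
    bhk_same_cluster_fun p hp ends o a hind hf hind0 (hf0 o)
  have hUnn : 0 ≤ expect p (fun ω => (clusterInEvent ends o 𝓤).indicator 1 ω *
      ((connEvent ends o a)ᶜ).indicator 1 ω) :=
    expect_mul_indicator_nonneg hp (g := (clusterInEvent ends o 𝓤).indicator 1)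
      (fun ω => Set.indicator_apply_nonneg fun _ => zero_le_one) _
  have hmid := mul_le_mul_of_nonneg_left hD' hUnn
  -- a bound for `f a · 1_U`
  obtain ⟨c, hc⟩ : ∃ c : R, ∀ ω, f a ω * (clusterInEvent ends o 𝓤).indicator 1 ω ≤ c :=
    ⟨Finset.univ.sup' Finset.univ_nonempty (fun ω => f a ω), fun ω => by
      calc f a ω * (clusterInEvent ends o 𝓤).indicator 1 ω ≤ f a ω * 1 :=
            mul_le_mul_of_nonneg_left (Set.indicator_apply_le' (fun _ => le_rfl)
              (fun _ => zero_le_one)) (hf0 a ω)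
        _ = f a ω := mul_one _
        _ ≤ _ := Finset.le_sup' (fun ω => f a ω) (Finset.mem_univ _)⟩
  have e1 : (fun ω => f a ω * (clusterInEvent ends o 𝓤).indicator 1 ω *
      ((connEvent ends o a)ᶜ).indicator 1 ω) =
      fun ω => (clusterInEvent ends o 𝓤).indicator 1 ω * f a ω *
        ((connEvent ends o a)ᶜ).indicator 1 ω := by
    funext ω; ring
  have e2 : (fun ω => f o ω * (clusterInEvent ends o 𝓤).indicator 1 ω *
      ((connEvent ends o a)ᶜ).indicator 1 ω) =
      fun ω => (clusterInEvent ends o 𝓤).indicator 1 ω * f o ω *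
        ((connEvent ends o a)ᶜ).indicator 1 ω := by
    funext ω; ring
  have hx : expect p (fun ω => f a ω * (clusterInEvent ends o 𝓤).indicator 1 ω *
      ((connEvent ends o a)ᶜ).indicator 1 ω) ≤ c * prob p (connEvent ends o a)ᶜ :=
    expect_mul_indicator_le hp (g := fun ω => f a ω * (clusterInEvent ends o 𝓤).indicator 1 ω)
      hc _
  have hx0 : 0 ≤ expect p (fun ω => f a ω * (clusterInEvent ends o 𝓤).indicator 1 ω *
      ((connEvent ends o a)ᶜ).indicator 1 ω) :=
    expect_mul_indicator_nonneg hp (g := fun ω => f a ω * (clusterInEvent ends o 𝓤).indicator 1 ω)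
      (fun ω => mul_nonneg (hf0 a ω) (Set.indicator_apply_nonneg fun _ => zero_le_one)) _
  have hy0 : 0 ≤ expect p (fun ω => f o ω * (clusterInEvent ends o 𝓤).indicator 1 ω *
      ((connEvent ends o a)ᶜ).indicator 1 ω) :=
    expect_mul_indicator_nonneg hp (g := fun ω => f o ω * (clusterInEvent ends o 𝓤).indicator 1 ω)
      (fun ω => mul_nonneg (hf0 o ω) (Set.indicator_apply_nonneg fun _ => zero_le_one)) _
  refine le_of_mul_le_mul_of_le' hx hx0 hy0 (prob_nonneg hp _) ?_
  rw [e1, e2]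
  exact hcross.trans (hmid.trans hsame)


omit [Fintype V] [DecidableEq V] [LinearOrder R] [IsStrictOrderedRing R] in
/-- `E(f x − m) = E(f x) − m`. -/
lemma expect_sub_const (p : E → R) (g : Config E → R) (m : R) :
    expect p (fun ω => g ω - m) = expect p g - m := by
  rw [show (fun ω => g ω - m) = g - fun _ => m from rfl, expect_sub, expect_const]

/-- **R10f for every monotone cluster property** (no sign condition): for an up-set `𝓤`,
`E f(a) ≤ E f(o)` implies `E[f(a) 1{C(o) ∈ 𝓤}] ≤ E[f(o) 1{C(o) ∈ 𝓤}]`. -/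
theorem orderPreserving_fun (p : E → R) (hp : IsProbVec p) (ends : E → Sym2 V) (o a : V)
    {𝓤 : Set (Set V)} (h𝓤 : IsUpperSet 𝓤) {f : V → Config E → R}
    (hf : IsMonotoneClusterProperty ends f) (h : expect p (f a) ≤ expect p (f o)) :
    expect p (fun ω => f a ω * (clusterInEvent ends o 𝓤).indicator 1 ω) ≤
      expect p (fun ω => f o ω * (clusterInEvent ends o 𝓤).indicator 1 ω) := by
  classical
  haveI : Nonempty (V × Config E) := ⟨(o, fun _ => false)⟩
  set m : R := Finset.univ.inf' Finset.univ_nonempty (fun xω : V × Config E => f xω.1 xω.2) with hm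
  have hm_le : ∀ x ω, m ≤ f x ω := fun x ω =>
    Finset.inf'_le (fun xω : V × Config E => f xω.1 xω.2) (Finset.mem_univ (x, ω))
  have hf' : IsMonotoneClusterProperty ends (fun x ω => f x ω - m) :=
    { mono := fun x ω ξ hc => sub_le_sub_right (hf.mono x ω ξ hc) m
      eq_of_openAdj := fun x y ω hxy => by simp only [hf.eq_of_openAdj x y ω hxy] }
  have h' : expect p (fun ω => f a ω - m) ≤ expect p (fun ω => f o ω - m) := by
    rw [expect_sub_const, expect_sub_const]
    linarith
  have key := orderPreserving_fun_of_nonneg p hp ends o a h𝓤 hf' (fun x ω => sub_nonneg.2 (hm_le x ω)) h'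
  have e : ∀ x, expect p (fun ω => (f x ω - m) * (clusterInEvent ends o 𝓤).indicator 1 ω) =
      expect p (fun ω => f x ω * (clusterInEvent ends o 𝓤).indicator 1 ω) -
        m * prob p (clusterInEvent ends o 𝓤) := by
    intro x
    rw [prob_eq_expect_indicator, ← expect_const_mul, ← expect_sub]
    congr 1
    funext ω
    simp only [Pi.sub_apply]
    ring
  rw [e, e] at key
  linarith

end OrderPreservationFun

end Summit.Ventures.PercRepro2
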